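import Literature.Probability.RandomPlanarGeometry.SLEStoppedCurveEvents
import Literature.Probability.RandomPlanarGeometry.SLEBoundaryHittingHolds
import Literature.Probability.RandomPlanarGeometry.SLEBoundaryHittingProofs
import Literature.Probability.RandomPlanarGeometry.SLESameSideLaw
import Literature.Probability.RandomPlanarGeometry.CritPercSLESpaceFillingFromTraceInputs
import Literature.Probability.RandomPlanarGeometry.RohdeSchrammCor35Proofs
import Literature.Probability.RandomPlanarGeometry.CritPercSLELocalityMartingaleProofs
import Literature.Probability.RandomPlanarGeometry.LocalMartingaleProofs
import HarnessLib

/-!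
# The two stopped-curve laws of chordal SLE_κ behind the splitting form of locality

Topic `Probability/RandomPlanarGeometry`; theorems only. For a chordal SLE_κ random curve `Γ`
(`κ > 4`) in a Dobrushin domain, transported from the trace by the boundary extension `Ψ` of its
chordal map, we compute the probability that **the curve stopped at its first hitting of a closed
set `F` has met a set `A`** (the events `stopAt F ⁻¹' hitsBefore A ∅` on which
`ChordalFamily.IsTargetIndependent`, Lawler–Schramm–Werner (2001), Cor. 2.3, is tested) in the
two boundary configurations of a four-marked domain:

* `measureReal_preimage_stopAt_hitsBefore_of_rays` — `A`, `F` pull back to real rays from `v`,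
  `u` of opposite signs: the probability is Lawler's two-sided crossing probability
  `Ψ_{2/κ}(|u|/(|u|+|v|))` (Lawler (2005), Prop. 6.33, `sle_measureReal_swallowingTime_lt_holds`;
  a.s. the event is `{T_v < T_u}`);
* `measureReal_preimage_stopAt_hitsBefore_of_segment` — `A` pulls back to the segment `[a, b]` and
  `F` to the ray from `b` (`0 < a < b` or `b < a < 0`): the probability is `1 - P[T_{|a|} = T_{|b|}]`
  (a.s. the complement is the same-side event `{T_a = T_b}` of Rohde–Schramm (2005), Lemma 6.6,
  up to null ties; order bookkeeping `realSegment_realRay_order`, `firstHit_realRay_eq_of_not`,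
  `ofReal_mem_range_of_firstHit_eq`), for every `κ > 4` at which SLE_κ is generated by a curve;
* `measure_swallowingTime_eq_eq_zero_of_eight_le` — for `κ ≥ 8` (trace generated by a curve) the
  same-side probability `P[T_y = T_x]`, `0 < y < x`, vanishes (space-filling trace, Rohde–Schramm
  Cor. 7.4 with the Update, from Cor. 3.5 in the tree); `measure_swallowingTime_neg_eq` — reflection
  symmetry of `P[T_y = T_x]` (adapted from the Summit-side
  `…CardyComplexConeSLESixFamiliesGiveCardySleSideTouchPart1.lean`, which Literature cannot import).

References: G. F. Lawler, O. Schramm, W. Werner, *Values of Brownian intersection exponents I*,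
Acta Math. 187 (2001), §3; S. Rohde, O. Schramm, *Basic properties of SLE*, Ann. of Math. 161
(2005), Lemma 6.6, Cor. 7.4; G. F. Lawler, *Conformally Invariant Processes in the Plane* (2005),
Rem. 6.6, Prop. 6.8, Prop. 6.33.
-/

noncomputable section

open Set Filter Topology MeasureTheory Complex Metric
open UpperHalfPlane (upperHalfPlaneSet)
open scoped NNReal ENNReal unitInterval

namespace Literature.Probability.RandomPlanarGeometry

/-! ### Real segments and rays -/

/-- Real segments `{z | im z = 0, re z ∈ [a, b]}` are closed. [folklore] -/
theorem isClosed_realSegment (a b : ℝ) : IsClosed {z : ℂ | z.im = 0 ∧ z.re ∈ uIcc a b} :=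
  (isClosed_eq continuous_im continuous_const).inter
    ((isClosed_Icc : IsClosed (uIcc a b)).preimage continuous_re)

/-- Order bookkeeping for a segment `[a, b]` followed by the ray from `b` away from `0`
(`0 < a < b` or `b < a < 0`): the ray from `b` is inside the ray from `a`, which is covered by the
segment and the ray from `b`; the segment is inside the ray from `a` and meets the ray from `b`
only at `b`. [folklore] -/
theorem realSegment_realRay_order {a b : ℝ} (hab : 0 < a ∧ a < b ∨ b < a ∧ a < 0) :
    realRay b ⊆ realRay a ∧ realRay a ⊆ {z : ℂ | z.im = 0 ∧ z.re ∈ uIcc a b} ∪ realRay b ∧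
      {z : ℂ | z.im = 0 ∧ z.re ∈ uIcc a b} ⊆ realRay a ∧
        ∀ z ∈ {z : ℂ | z.im = 0 ∧ z.re ∈ uIcc a b}, z ∈ realRay b → z = (b : ℂ) := by
  rcases hab with ⟨ha, hlt⟩ | ⟨hlt, ha⟩
  · have hb : 0 < b := ha.trans hlt
    refine ⟨realRay_subset_realRay_of_pos ha hlt.le, ?_, ?_, ?_⟩
    · rintro z ⟨hz, hza, -⟩
      by_cases hzb : b ≤ z.re
      · exact Or.inr ⟨hz, fun _ ↦ hzb, fun h ↦ absurd hb h.le.not_gt⟩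
      · refine Or.inl ⟨hz, ?_⟩
        rw [uIcc_of_le hlt.le]
        exact ⟨hza ha, (not_le.1 hzb).le⟩
    · rintro z ⟨hz, hzr⟩
      rw [uIcc_of_le hlt.le] at hzr
      exact ⟨hz, fun _ ↦ hzr.1, fun h ↦ absurd ha h.le.not_gt⟩
    · rintro z ⟨hz, hzr⟩ ⟨-, hzb, -⟩
      rw [uIcc_of_le hlt.le] at hzr
      exact Complex.ext (by simpa using le_antisymm hzr.2 (hzb hb)) (by simpa using hz)
  · have hb : b < 0 := hlt.trans ha
    refine ⟨?_, ?_, ?_, ?_⟩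
    · rintro z ⟨hz, -, hzb⟩
      exact ⟨hz, fun h ↦ absurd ha h.le.not_gt, fun _ ↦ (hzb hb).trans hlt.le⟩
    · rintro z ⟨hz, -, hza⟩
      by_cases hzb : z.re ≤ b
      · exact Or.inr ⟨hz, fun h ↦ absurd hb h.le.not_gt, fun _ ↦ hzb⟩
      · refine Or.inl ⟨hz, ?_⟩
        rw [uIcc_of_ge hlt.le]
        exact ⟨(not_le.1 hzb).le, hza ha⟩
    · rintro z ⟨hz, hzr⟩
      rw [uIcc_of_ge hlt.le] at hzr
      exact ⟨hz, fun h ↦ absurd ha h.le.not_gt, fun _ ↦ hzr.2⟩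
    · rintro z ⟨hz, hzr⟩ ⟨-, -, hzb⟩
      rw [uIcc_of_ge hlt.le] at hzr
      exact Complex.ext (by simpa using le_antisymm (hzb hb) hzr.1) (by simpa using hz)

/-! ### Deterministic order lemmas for the segment configuration -/

/-- If the path does NOT hit `SA` at a finite time before (weakly) the ray from `b`, then the rays
from `a` and from `b` are first hit at the same time (`realRay b ⊆ realRay a ⊆ SA ∪ realRay b`).
[folklore] -/
theorem firstHit_realRay_eq_of_not {γ : ℝ≥0 → ℂ} (hγ : Continuous γ) {SA : Set ℂ} {a b : ℝ}
    (hsub : realRay b ⊆ realRay a) (hcov : realRay a ⊆ SA ∪ realRay b)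
    (h : ¬ (firstHit γ SA ≤ firstHit γ (realRay b) ∧ firstHit γ SA < ⊤)) :
    firstHit γ (realRay a) = firstHit γ (realRay b) := by
  refine le_antisymm (firstHit_mono γ hsub) ?_
  by_contra hlt
  rw [not_le] at hlt
  obtain ⟨t, ht, hγt⟩ := exists_firstHit_eq_coe hγ (isClosed_realRay a) hlt.ne_top
  have hγb : γ t ∉ realRay b := fun hb ↦ by
    have := firstHit_le (S := realRay b) hb
    rw [← ht] at this
    exact absurd this (not_le.2 hlt)
  have hγA : γ t ∈ SA := (hcov hγt).resolve_right hγb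
  refine h ⟨?_, ?_⟩
  · exact (firstHit_le hγA).trans (ht ▸ hlt.le)
  · exact (firstHit_le hγA).trans_lt (WithTop.coe_lt_top t)

/-- If the path hits `SA ⊆ realRay a` at a finite time before (weakly) the ray from `b`, and the two
rays are first hit at the same time, then the first contact with `SA` is on the ray from `b`, hence
is the point `b` when `SA` meets that ray only at `b`. [folklore] -/
theorem ofReal_mem_range_of_firstHit_eq {γ : ℝ≥0 → ℂ} (hγ : Continuous γ) {SA : Set ℂ}
    (hSA : IsClosed SA) {a b : ℝ} (hSAsub : SA ⊆ realRay a)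
    (hinter : ∀ z ∈ SA, z ∈ realRay b → z = (b : ℂ))
    (hE : firstHit γ SA ≤ firstHit γ (realRay b) ∧ firstHit γ SA < ⊤)
    (heq : firstHit γ (realRay a) = firstHit γ (realRay b)) : (b : ℂ) ∈ range γ := by
  obtain ⟨t₀, ht₀, hγt₀⟩ := exists_firstHit_eq_coe hγ hSA hE.2.ne
  have h1 : firstHit γ (realRay a) ≤ t₀ := firstHit_le (hSAsub hγt₀)
  have h2 : firstHit γ (realRay b) = t₀ :=
    le_antisymm (heq ▸ h1) (ht₀ ▸ hE.1)
  obtain ⟨t₁, ht₁, hγt₁⟩ := exists_firstHit_eq_coe hγ (isClosed_realRay b) (h2 ▸ WithTop.coe_ne_top)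
  have h01 : t₁ = t₀ := WithTop.coe_injective (ht₁.symm.trans h2)
  rw [h01] at hγt₁
  exact ⟨t₀, hinter _ hγt₀ hγt₁⟩

/-! ### Reflection and the same-side law beyond `κ = 8` -/

/-- **Reflection**: `P[T_{-y} = T_{-x}] = P[T_y = T_x]` for `0 < x`, `0 < y` (the driving functions
`W` and `-W` have the same law, `identDistrib_sleDriving_neg`, and `T_{-x}(W) = T_x(-W)`,
`swallowingTime_neg_ofReal`). Lawler (2005), §6.7 ("by symmetry"). [cite: Lawler2005, §6.7] -/
theorem measure_swallowingTime_neg_eq (κ : ℝ≥0) {x y : ℝ} (hx : 0 < x) (hy : 0 < y) :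
    Process.preWienerMeasure {ω | Loewner.swallowingTime (sleDriving κ ω) ((-y : ℝ) : ℂ) =
        Loewner.swallowingTime (sleDriving κ ω) ((-x : ℝ) : ℂ)} =
      Process.preWienerMeasure
        {ω | Loewner.swallowingTime (sleDriving κ ω) y = Loewner.swallowingTime (sleDriving κ ω) x} := by
  -- adapted from Summits/…/CardyComplexConeSLESixFamiliesGiveCardySleSideTouchPart1.lean
  have hmeas := measurableSet_swallowTogetherEvent (x := x) (y := y) hx hy
  have hlaw := (identDistrib_sleDriving_neg κ).measure_mem_eq hmeas
  have hpos : {ω : ℝ≥0 → ℝ | Loewner.swallowingTime (sleDriving κ ω) y =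
      Loewner.swallowingTime (sleDriving κ ω) x} =
      (fun ω t ↦ sleDriving κ ω t) ⁻¹' swallowTogetherEvent x y := by
    ext ω
    exact (mem_swallowTogetherEvent_iff (continuous_sleDriving κ ω) (sleDriving_zero κ ω) x y).symm
  have hneg : {ω : ℝ≥0 → ℝ | Loewner.swallowingTime (sleDriving κ ω) ((-y : ℝ) : ℂ) =
      Loewner.swallowingTime (sleDriving κ ω) ((-x : ℝ) : ℂ)} =
      (fun ω t ↦ -sleDriving κ ω t) ⁻¹' swallowTogetherEvent x y := by
    ext ω
    have e1 : Loewner.swallowingTime (fun t ↦ -sleDriving κ ω t) (y : ℂ) =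
        Loewner.swallowingTime (sleDriving κ ω) ((-y : ℝ) : ℂ) := by
      simpa using Loewner.swallowingTime_neg_ofReal (sleDriving κ ω) (-y)
    have e2 : Loewner.swallowingTime (fun t ↦ -sleDriving κ ω t) (x : ℂ) =
        Loewner.swallowingTime (sleDriving κ ω) ((-x : ℝ) : ℂ) := by
      simpa using Loewner.swallowingTime_neg_ofReal (sleDriving κ ω) (-x)
    rw [mem_preimage, mem_swallowTogetherEvent_iff (w := fun t ↦ -sleDriving κ ω t)
      (continuous_sleDriving κ ω).neg (by simp [sleDriving_zero]) x y, e1, e2]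
    rfl
  rw [hneg, hpos, hlaw]

/-- **`{T_y = T_x}` is an event** for real `x, y` of the same sign. [folklore] -/
theorem measurableSet_sle_swallowingTime_eq_of_mul_pos (κ : ℝ≥0) {x y : ℝ} (hxy : 0 < x * y) :
    MeasurableSet {ω : ℝ≥0 → ℝ | Loewner.swallowingTime (sleDriving κ ω) y =
      Loewner.swallowingTime (sleDriving κ ω) x} := by
  rcases lt_or_gt_of_ne (show x ≠ 0 from fun h ↦ by simp [h] at hxy) with hx | hx
  · exact measurableSet_sle_swallowingTime_eq_of_neg κ hx (by nlinarith)
  · exact measurableSet_sle_swallowingTime_eq κ hx (by nlinarith)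

/-- **For `κ ≥ 8` two positive points are a.s. swallowed at different times**: if SLE_κ is
generated by a curve (`HasSLETrace κ`, automatic for `κ > 8`), then `P[T_y = T_x] = 0` for
`0 < y < x`. The trace is space-filling (Rohde–Schramm (2005), Cor. 7.4 with the Update, in the
tree from Cor. 3.5: `ae_isSpaceFilling_sleTrace_of_cor35_of_hasSLETrace`), so it visits `y`,
whereas `T_y = T_x` means that `[y, x)` is never visited
(`IsGeneratedByCurve.forall_notMem_range_iff_swallowingTime_eq`).
[cite: RohdeSchramm2005, Cor. 7.4 and Lemma 6.6] -/
theorem measure_swallowingTime_eq_eq_zero_of_eight_le {κ : ℝ≥0} (h8 : 8 ≤ κ) (hT : HasSLETrace κ)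
    {x y : ℝ} (hy : 0 < y) (hyx : y < x) :
    Process.preWienerMeasure {ω | Loewner.swallowingTime (sleDriving κ ω) y =
      Loewner.swallowingTime (sleDriving κ ω) x} = 0 := by
  rw [measure_eq_zero_iff_ae_notMem]
  filter_upwards [hT, ae_isSpaceFilling_sleTrace_of_cor35_of_hasSLETrace
    (RohdeSchramm2005_cor35_holds _) h8 hT] with ω hG hfill heq
  have hgen := Loewner.isGeneratedByCurve_trace hG
  have hnot := (hgen.forall_notMem_range_iff_swallowingTime_eq (continuous_sleDriving κ ω)
    (sleDriving_zero κ ω) hy hyx.le).2 heq y le_rfl hyx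
  refine hnot ?_
  change (y : ℂ) ∈ range (sleTrace κ ω)
  rw [hfill]
  exact mem_closure_upperHalfPlaneSet_iff.2 (by simp)

/-- **The same-side probability only depends on the moduli**: for `0 < a < b` or `b < a < 0`,
`P[T_a = T_b] = P[T_{|a|} = T_{|b|}]` (reflection, `measure_swallowingTime_neg_eq`).
[cite: Lawler2005, §6.7] -/
theorem measure_swallowingTime_eq_abs (κ : ℝ≥0) {a b : ℝ} (hab : 0 < a ∧ a < b ∨ b < a ∧ a < 0) :
    Process.preWienerMeasure {ω | Loewner.swallowingTime (sleDriving κ ω) a =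
        Loewner.swallowingTime (sleDriving κ ω) b} =
      Process.preWienerMeasure {ω | Loewner.swallowingTime (sleDriving κ ω) ((|a| : ℝ) : ℂ) =
        Loewner.swallowingTime (sleDriving κ ω) ((|b| : ℝ) : ℂ)} := by
  rcases hab with ⟨ha, hlt⟩ | ⟨hlt, ha⟩
  · rw [abs_of_pos ha, abs_of_pos (ha.trans hlt)]
  · have hb : b < 0 := hlt.trans ha
    rw [abs_of_neg ha, abs_of_neg hb, ← measure_swallowingTime_neg_eq κ (neg_pos.2 hb) (neg_pos.2 ha)]
    simp only [neg_neg]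

/-! ### The two stopped-curve laws -/

section Laws

variable {κ : ℝ≥0} {D : DobrushinDomain} {Γ : (ℝ≥0 → ℝ) → CurveClass ℂ}
  {ψ : ConformalEquiv upperHalfPlaneSet D.carrier}

/-- **Two-sided configuration (Lawler (2005), Prop. 6.33).** Let `Γ` be transported from the SLE_κ
trace (`κ > 4`) by the boundary extension `Ψ` of the chordal map `ψ`, and let `A`, `F` (`F` closed)
pull back under `Ψ` to the real rays from `v` and from `u`, of opposite signs. Then the curve
stopped on `F` has met `A` with probability `Ψ_{2/κ}(|u|/(|u|+|v|))`: a.s. the event is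
`{T_v < T_u}` (swallowing = hitting of rays, Lawler Rem. 6.6; the positive point is a.s. swallowed,
Prop. 6.8), whose probability is Lawler's crossing probability. [cite: Lawler2005, Prop. 6.33] -/
theorem measureReal_preimage_stopAt_hitsBefore_of_rays (hκ : 4 < κ)
    (hae : ∀ᵐ ω ∂Process.preWienerMeasure,
      Loewner.IsGeneratedByCurve (sleDriving κ ω) (sleTrace κ ω) ∧
        ∃ c : Curve ℂ, Γ ω = CurveClass.mk c ∧
          IsCompactifiedImage ψ.boundaryExtension (sleTrace κ ω) (D.pt 1) c)
    {A F : Set ℂ} (hF : IsClosed F) {u v : ℝ} (huv : u < 0 ∧ 0 < v ∨ v < 0 ∧ 0 < u)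
    (hΨA : ∀ z : ℂ, 0 ≤ z.im → (ψ.boundaryExtension z ∈ A ↔ z ∈ realRay v))
    (hΨF : ∀ z : ℂ, 0 ≤ z.im → (ψ.boundaryExtension z ∈ F ↔ z ∈ realRay u)) :
    Process.preWienerMeasure.real
        (Γ ⁻¹' (CurveClass.stopAt F ⁻¹' CurveClass.hitsBefore A (∅ : Set ℂ))) =
      swallowingProb (2 / (κ : ℝ)) (|u| / (|u| + |v|)) := by
  have hu0 : u ≠ 0 := by rcases huv with ⟨hu, -⟩ | ⟨-, hu⟩ <;> [exact hu.ne; exact hu.ne']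
  have hv0 : v ≠ 0 := by rcases huv with ⟨-, hv⟩ | ⟨hv, -⟩ <;> [exact hv.ne'; exact hv.ne]
  have hpos : 0 < max u v := by
    rcases huv with ⟨-, hv⟩ | ⟨-, hu⟩
    · exact lt_max_of_lt_right hv
    · exact lt_max_of_lt_left hu
  have key : Γ ⁻¹' (CurveClass.stopAt F ⁻¹' CurveClass.hitsBefore A (∅ : Set ℂ))
      =ᵐ[Process.preWienerMeasure]
      {ω | Loewner.swallowingTime (sleDriving κ ω) v < Loewner.swallowingTime (sleDriving κ ω) u} := by
    filter_upwards [hae, sle_swallowingTime_ofReal_lt_top_holds hκ] with ω hω hfinω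
    obtain ⟨hgen, c, hΓc, hc⟩ := hω
    have hTu := sle_swallowingTime_ofReal_eq_firstHit_holds κ ω hgen hu0
    have hTv := sle_swallowingTime_ofReal_eq_firstHit_holds κ ω hgen hv0
    have hfin := hfinω (max u v) hpos
    have hiff := mk_mem_stopAt_preimage_hitsBefore_iff (b := D.pt 1) hF (isClosed_realRay v)
      (isClosed_realRay u) hgen.continuous (fun t ↦ hΨA _ (hgen.im_nonneg t))
      (fun t ↦ hΨF _ (hgen.im_nonneg t)) hc
    refine propext ?_
    change Γ ω ∈ CurveClass.stopAt F ⁻¹' CurveClass.hitsBefore A ∅ ↔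
      Loewner.swallowingTime (sleDriving κ ω) v < Loewner.swallowingTime (sleDriving κ ω) u
    rw [hΓc, hiff, hTu, hTv]
    constructor
    · rintro (⟨hle, hfinv⟩ | ⟨htop, -⟩)
      · refine hle.lt_of_ne fun heq ↦ ?_
        obtain ⟨t₀, ht₀, hγt₀⟩ := exists_firstHit_eq_coe hgen.continuous (isClosed_realRay v)
          hfinv.ne
        obtain ⟨t₁, ht₁, hγt₁⟩ := exists_firstHit_eq_coe hgen.continuous (isClosed_realRay u)
          (heq ▸ hfinv.ne)
        have h01 : t₀ = t₁ := WithTop.coe_injective (ht₀.symm.trans (heq.trans ht₁))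
        rcases huv with ⟨hu, hv⟩ | ⟨hv, hu⟩
        · exact (disjoint_realRay hu hv).ne_of_mem hγt₁ hγt₀ (by rw [h01])
        · exact (disjoint_realRay hv hu).ne_of_mem hγt₀ hγt₁ (by rw [h01])
      · rcases huv with ⟨hu, hv⟩ | ⟨hv, hu⟩
        · rw [htop, ← hTv, ← max_eq_right (hu.trans hv).le]
          exact hfin
        · exfalso
          rw [← hTu, ← max_eq_left (hv.trans hu).le] at htop
          exact hfin.ne htop
    · exact fun hlt ↦ Or.inl ⟨hlt.le, hlt.trans_le le_top⟩
  rw [measureReal_congr key]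
  rcases huv with ⟨hu, hv⟩ | ⟨hv, hu⟩
  · have h := (sle_measureReal_swallowingTime_lt_holds hκ hv (neg_pos.2 hu)).1
    simp only [neg_neg] at h
    rw [h, abs_of_neg hu, abs_of_pos hv, add_comm]
  · have h := (sle_measureReal_swallowingTime_lt_holds hκ (neg_pos.2 hv) hu).2
    simp only [neg_neg] at h
    rw [h, abs_of_pos hu, abs_of_neg hv, add_comm]

/-- **Same-side configuration (Rohde–Schramm (2005), Lemma 6.6).** Let `Γ` be transported from the
SLE_κ trace (`κ > 4`, SLE_κ generated by a curve) by the boundary extension `Ψ` of the chordal map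
`ψ`, let `A` (off the target point) pull back under `Ψ` to the real segment `[a, b]` and the closed
set `F` to the real ray from `b`, where `0 < a < b` or `b < a < 0`. Then the curve stopped on `F`
has met `A` with probability `1 - P[T_{|a|} = T_{|b|}]`: a.s. the complement of the event is
`{T_a = T_b}` (up to the null event that `b` is on the trace when `κ < 8`, resp. the null event
`{T_a = T_b}` itself when `κ ≥ 8`), and reflection handles the signs.
[cite: RohdeSchramm2005, Lemma 6.6] -/
theorem measureReal_preimage_stopAt_hitsBefore_of_segment (hκ : 4 < κ) (hT : HasSLETrace κ)
    (hae : ∀ᵐ ω ∂Process.preWienerMeasure,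
      Loewner.IsGeneratedByCurve (sleDriving κ ω) (sleTrace κ ω) ∧
        ∃ c : Curve ℂ, Γ ω = CurveClass.mk c ∧
          IsCompactifiedImage ψ.boundaryExtension (sleTrace κ ω) (D.pt 1) c)
    {A F : Set ℂ} (hF : IsClosed F) (hbA : D.pt 1 ∉ A) {a b : ℝ}
    (hab : 0 < a ∧ a < b ∨ b < a ∧ a < 0)
    (hΨA : ∀ z : ℂ, 0 ≤ z.im → (ψ.boundaryExtension z ∈ A ↔ z.im = 0 ∧ z.re ∈ uIcc a b))
    (hΨF : ∀ z : ℂ, 0 ≤ z.im → (ψ.boundaryExtension z ∈ F ↔ z ∈ realRay b)) :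
    Process.preWienerMeasure.real
        (Γ ⁻¹' (CurveClass.stopAt F ⁻¹' CurveClass.hitsBefore A (∅ : Set ℂ))) =
      1 - Process.preWienerMeasure.real {ω |
        Loewner.swallowingTime (sleDriving κ ω) ((|a| : ℝ) : ℂ) =
          Loewner.swallowingTime (sleDriving κ ω) ((|b| : ℝ) : ℂ)} := by
  haveI := isProbabilityMeasure_preWienerMeasure'
  have ha0 : a ≠ 0 := by rcases hab with ⟨ha, -⟩ | ⟨-, ha⟩ <;> [exact ha.ne'; exact ha.ne]
  have hb0 : b ≠ 0 := by
    rcases hab with ⟨ha, h⟩ | ⟨h, ha⟩ <;> [exact (ha.trans h).ne'; exact (h.trans ha).ne]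
  have habpos : 0 < a * b := by
    rcases hab with ⟨ha, h⟩ | ⟨h, ha⟩
    · exact mul_pos ha (ha.trans h)
    · exact mul_pos_of_neg_of_neg ha (h.trans ha)
  obtain ⟨hsub, hcov, hSAsub, hinter⟩ := realSegment_realRay_order hab
  set E : Set (ℝ≥0 → ℝ) := Γ ⁻¹' (CurveClass.stopAt F ⁻¹' CurveClass.hitsBefore A (∅ : Set ℂ))
    with hE
  set S : Set (ℝ≥0 → ℝ) := {ω | Loewner.swallowingTime (sleDriving κ ω) a =
    Loewner.swallowingTime (sleDriving κ ω) b} with hS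
  -- pathwise: `Eᶜ ⊆ S` and `E ∩ S ⊆ {b on the trace}`
  have h1 : ∀ᵐ ω ∂Process.preWienerMeasure, (ω ∉ E → ω ∈ S) ∧
      (ω ∈ E → ω ∈ S → (b : ℂ) ∈ range (sleTrace κ ω)) := by
    filter_upwards [hae] with ω hω
    obtain ⟨hgen, c, hΓc, hc⟩ := hω
    have hTa := sle_swallowingTime_ofReal_eq_firstHit_holds κ ω hgen ha0
    have hTb := sle_swallowingTime_ofReal_eq_firstHit_holds κ ω hgen hb0
    have hiff := mk_mem_stopAt_preimage_hitsBefore_iff (b := D.pt 1) hF (isClosed_realSegment a b)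
      (isClosed_realRay b) hgen.continuous (fun t ↦ hΨA _ (hgen.im_nonneg t))
      (fun t ↦ hΨF _ (hgen.im_nonneg t)) hc
    have hiff' : ω ∈ E ↔ firstHit (sleTrace κ ω) {z : ℂ | z.im = 0 ∧ z.re ∈ uIcc a b} ≤
        firstHit (sleTrace κ ω) (realRay b) ∧
          firstHit (sleTrace κ ω) {z : ℂ | z.im = 0 ∧ z.re ∈ uIcc a b} < ⊤ := by
      change Γ ω ∈ CurveClass.stopAt F ⁻¹' CurveClass.hitsBefore A ∅ ↔ _
      rw [hΓc, hiff]
      exact ⟨fun h ↦ h.resolve_right fun h' ↦ hbA h'.2, Or.inl⟩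
    have hS' : ω ∈ S ↔ firstHit (sleTrace κ ω) (realRay a) = firstHit (sleTrace κ ω) (realRay b) := by
      change Loewner.swallowingTime (sleDriving κ ω) a = Loewner.swallowingTime (sleDriving κ ω) b ↔ _
      rw [hTa, hTb]
    refine ⟨fun hn ↦ hS'.2 (firstHit_realRay_eq_of_not hgen.continuous hsub hcov
      (fun h ↦ hn (hiff'.2 h))), fun hEω hSω ↦ ?_⟩
    exact ofReal_mem_range_of_firstHit_eq hgen.continuous (isClosed_realSegment a b) hSAsub
      hinter (hiff'.1 hEω) (hS'.1 hSω)
  -- the null event killing the ties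
  have h2 : ∀ᵐ ω ∂Process.preWienerMeasure, ω ∈ E → ω ∈ S → False := by
    rcases lt_or_ge κ 8 with hκ8 | hκ8
    · filter_upwards [h1, ae_ofReal_notMem_range_sleTrace hκ hκ8 hb0] with ω hω hbω
      exact fun hEω hSω ↦ hbω (hω.2 hEω hSω)
    · have hzero : Process.preWienerMeasure S = 0 := by
        rw [hS, measure_swallowingTime_eq_abs κ hab]
        have hlt : |a| < |b| := by
          rcases hab with ⟨ha, h⟩ | ⟨h, ha⟩
          · rwa [abs_of_pos ha, abs_of_pos (ha.trans h)]
          · rw [abs_of_neg ha, abs_of_neg (h.trans ha)]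
            linarith
        exact measure_swallowingTime_eq_eq_zero_of_eight_le hκ8 hT (abs_pos.2 ha0) hlt
      have hS0 : ∀ᵐ ω ∂Process.preWienerMeasure, ω ∉ S := measure_eq_zero_iff_ae_notMem.1 hzero
      filter_upwards [hS0] with ω hω
      exact fun _ hSω ↦ hω hSω
  have key : E =ᵐ[Process.preWienerMeasure] (Sᶜ : Set _) := by
    filter_upwards [h1, h2] with ω hω hω'
    exact propext ⟨fun hEω hSω ↦ hω' hEω hSω, fun hn ↦ by_contra fun hEω ↦ hn (hω.1 hEω)⟩
  have hSm : MeasurableSet S := by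
    rw [hS]
    have := measurableSet_sle_swallowingTime_eq_of_mul_pos κ (x := b) (y := a) (by linarith)
    exact this
  rw [measureReal_congr key, measureReal_compl hSm, probReal_univ, hS, measureReal_def,
    measure_swallowingTime_eq_abs κ hab, ← measureReal_def]

end Laws

end Literature.Probability.RandomPlanarGeometry
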